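import Literature.NumberTheory.GaloisRepresentations.LabelledWeightsCoeffBaseChange
import Literature.NumberTheory.GaloisRepresentations.LabelledWeightsDeRhamRank
import Literature.NumberTheory.Automorphic.ReciprocityGLnQlModelProofs
import HarnessLib

/-!
# `D_τ(ρ)` is finite-dimensional over `ℚ̄_p` for EVERY continuous `ρ : Γ_K → GL_n(ℚ̄_p)`
# (Fontaine's inequality on a finite `ℚ_p`-model; Skinner / Buzzard–Gee: models exist by Baire)

Topic `NumberTheory/GaloisRepresentations`; theorems only (no definition, no named fact).

For a period-ring datum `𝔅` over `(Γ_K, ℚ_p, K)` with `K/ℚ_p` finite (intended: Fontaine's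
`B_dR(K)`), a continuous framed `ρ : Γ_K → GL_n(ℚ̄_p)` and a `ℚ_p`-embedding `τ : K → ℚ̄_p`, the
`τ`-component `D_τ(ρ) ⊆ ℚ̄_pⁿ ⊗_{ℚ_p} B` of `D(ρ)` is a FINITE-DIMENSIONAL `ℚ̄_p`-vector space
(`FramedRep.finiteDimensional_labelD_padicAlgCl`) — with no de Rham / admissibility hypothesis (the
tree had this only for de Rham `ρ`, `FramedRep.IsDeRhamWith.finiteDimensional_labelD`, where a finite
model is part of the definition).  Proof: `ρ` has a model `rE'` over a finite `E'/ℚ_p ⊆ ℚ̄_p`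
(accepted `exists_hasQlModel_holds`, Baire category on the compact group `Γ_K`), which we enlarge to
contain every `τ(K)` (`exists_intermediateField_ge_forall_fieldRange_le`); over the finite `E'`,
`D_{τ₀}(rE') ⊆ D(rE')` is finite-dimensional by Fontaine's inequality `dim D ≤ dim V` counted over
`ℚ_p` (`rank_D_le`, `finrank_D_le_holds`, `finite_coeffD_and_finrank_le`;
`finiteDimensional_labelD_of_finiteDimensional`); and `D_τ(ρ) = (Q ⊗ 1)(ℚ̄_p · ι(D_{τ₀}(rE')))`
(`labelD_conj`, `finiteDimensional_labelD_baseChange`).  The pinned corollary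
`fontainePst_finiteDimensional_labelD` is the form used with THE summit datum (it makes the block
additivity `labelledHodgeTateWeights_blockDiagonal` unconditional for `ℚ̄_ℓ`-coefficients).

## References

* [FontaineAsterisque223III] J.-M. Fontaine, *Représentations p-adiques semi-stables*, Astérisque
  223 (1994), Exp. III Prop. 1.4.2 and Thm. 1.5.2 (`dim_E D_B(V) ≤ dim V`).
* [BuzzardGeeLMS2014] K. Buzzard, T. Gee, *The conjectural connections between automorphic
  representations and Galois representations* (2014), footnote to Conj. 3.2.1 (continuous
  representations of compact groups into `GL_n(ℚ̄_p)` land in `GL_n(E)` for a finite `E/ℚ_p`).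
* [Patrikis2019] S. Patrikis, *Variations on a theorem of Tate*, Mem. AMS 258 (2019), §2.7.1
  (labelled Hodge–Tate data for `ℚ̄_ℓ`-coefficients via a finite model).
-/

noncomputable section

open scoped TensorProduct
open Field Literature.NumberTheory.Automorphic Literature.NumberTheory.PAdicHodge

namespace Literature.NumberTheory.GaloisRepresentations

/-! ### §1 Finite coefficients: `D_τ` is finite-dimensional by Fontaine's inequality -/

namespace PeriodRingData

universe u v v' w w'

-- Mathlib's own global value of `maxSynthPendingDepth` (see `PeriodRingData.rank_D_le`).
set_option maxSynthPendingDepth 3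

/-- **`D_τ(r)` is finite-dimensional over `E` when `E/P` and `F/P` are finite**: `D(r|_P)` is a
finite `F`-space with `dim_F D ≤ dim_P Eⁿ` (Fontaine's inequality, `rank_D_le`,
`finrank_D_le_holds`), so `D(r)` with coefficients is a finite `E`-space
(`finite_coeffD_and_finrank_le`) and `D_τ(r) ⊆ D(r)` (`labelD_le_coeffD`).
[cite: FontaineAsterisque223III, Prop. 1.4.2 and Thm. 1.5.2] -/
theorem finiteDimensional_labelD_of_finiteDimensional {Γ : Type u} [Group Γ] [TopologicalSpace Γ]
    {P : Type v} {F : Type v'} [Field P] [Field F] [Algebra P F] [TopologicalSpace P]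
    (𝔅 : PeriodRingData.{u, v, v', w} Γ P F) {E : Type w'} [Field E] [Algebra P E] [TopologicalSpace E]
    [IsTopologicalRing E] [FiniteDimensional P F] [FiniteDimensional P E]
    {n : ℕ} (r : FramedRep Γ E n) (τ : F →+* E) :
    FiniteDimensional E (𝔅.labelD (FramedRep.toContinuousRep r) τ) := by
  haveI : Module.Finite F (𝔅.D ((FramedRep.toContinuousRep r).restrictScalars P)) :=
    Module.rank_lt_aleph0_iff.1 ((𝔅.rank_D_le _).trans_lt Cardinal.natCast_lt_aleph0)
  have hD : Module.finrank F (𝔅.D ((FramedRep.toContinuousRep r).restrictScalars P)) ≤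
      Module.finrank P (Fin n → E) :=
    𝔅.finrank_D_le_holds _
  obtain ⟨hfin, -⟩ := 𝔅.finite_coeffD_and_finrank_le (FramedRep.toContinuousRep r) hD
  haveI := hfin
  exact Submodule.finiteDimensional_of_le (𝔅.labelD_le_coeffD (FramedRep.toContinuousRep r) τ)

end PeriodRingData

/-! ### §2 `ℚ̄_p`-coefficients: a finite model (Baire) and coefficient base change -/

namespace FramedRep

open PeriodRingData

-- Mathlib's own global value of `maxSynthPendingDepth` (see `LabelledWeightsTwist`); the large
-- tensor types also need a higher instance-synthesis budget.
set_option maxSynthPendingDepth 3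
set_option synthInstance.maxHeartbeats 200000

variable {K : Type} [Field K] {p : ℕ} [Fact p.Prime] [Algebra ℚ_[p] K]

/-- **`D_τ(ρ)` is finite-dimensional over `ℚ̄_p` for every continuous `ρ : Γ_K →ₜ* GL_n(ℚ̄_p)`**
(`K/ℚ_p` finite, any period-ring datum; no de Rham hypothesis): `ρ` has a model `rE'` over a finite
`E' ⊆ ℚ̄_p` containing every `τ(K)` (Baire, `exists_hasQlModel_holds`;
`exists_intermediateField_ge_forall_fieldRange_le`), `D_{τ₀}(rE')` is finite over `E'`
(`finiteDimensional_labelD_of_finiteDimensional`) and `D_τ(ρ) = (Q ⊗ 1)(ℚ̄_p · ι(D_{τ₀}(rE')))`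
(`labelD_conj`, `finiteDimensional_labelD_baseChange`).
[cite: BuzzardGeeLMS2014, footnote to Conj. 3.2.1] [cite: FontaineAsterisque223III, Prop. 1.4.2 and Thm. 1.5.2]
[cite: Patrikis2019, §2.7.1] -/
theorem finiteDimensional_labelD_padicAlgCl [FiniteDimensional ℚ_[p] K]
    (𝔅 : PeriodRingData.{0, 0, 0, 0} (absoluteGaloisGroup K) ℚ_[p] K) {n : ℕ}
    (ρ : FramedRep (absoluteGaloisGroup K) (PadicAlgCl p) n) (τ : K →ₐ[ℚ_[p]] PadicAlgCl p) :
    FiniteDimensional (PadicAlgCl p) (𝔅.labelD (FramedRep.toContinuousRep ρ) τ.toRingHom) := by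
  classical
  -- a finite model `rE₀` over `E₀` (Baire), enlarged to `E'` containing all embeddings of `K`
  obtain ⟨E₀, rE₀, hfin₀, hmodel₀⟩ := exists_hasQlModel_holds ρ
  haveI : FiniteDimensional ℚ_[p] E₀ := hfin₀
  obtain ⟨E', hfin', hle, hE'⟩ := exists_intermediateField_ge_forall_fieldRange_le (K := K) E₀
  haveI : FiniteDimensional ℚ_[p] E' := hfin'
  have hsplit := card_algHom_eq_finrank_of_forall_fieldRange_le (K := K) E' hE'
  have hcont : Continuous (IntermediateField.inclusion hle).toRingHom := continuous_inclusion hle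
  let rE' : FramedRep (absoluteGaloisGroup K) E' n :=
    rE₀.baseChange (IntermediateField.inclusion hle).toRingHom hcont
  obtain ⟨Q, hQ⟩ := hmodel₀
  have hbc : rE'.baseChange (algebraMap E' (PadicAlgCl p)) continuous_subtype_val =
      rE₀.baseChange (algebraMap E₀ (PadicAlgCl p)) continuous_subtype_val :=
    ContinuousMonoidHom.ext fun g => Units.ext (Matrix.ext fun i j => rfl)
  have hρeq : ρ = (rE'.baseChange (algebraMap E' (PadicAlgCl p)) continuous_subtype_val).conj Q := by
    rw [hbc, hQ]
  -- the embedding `τ` factors through `E'`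
  let τ₀ : K →ₐ[ℚ_[p]] E' := (IntermediateField.inclusion (hE' τ)).comp τ.equivFieldRange.toAlgHom
  have hτ : τ.toRingHom = (extEmb (E := PadicAlgCl p) τ₀).toRingHom := RingHom.ext fun x => rfl
  -- finiteness over the finite `E'`, then over `ℚ̄_p`
  haveI : ContinuousSMul ℚ_[p] E' := IntermediateField.continuousSMul_padicAlgCl E'
  haveI : FiniteDimensional E' (𝔅.labelD (FramedRep.toContinuousRep rE') τ₀.toRingHom) :=
    𝔅.finiteDimensional_labelD_of_finiteDimensional rE' τ₀.toRingHom
  rw [hρeq, 𝔅.labelD_conj, hτ]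
  haveI := 𝔅.finiteDimensional_labelD_baseChange rE' continuous_subtype_val hsplit τ₀
  infer_instance

/-- Hence **every `Fil^i D_τ(ρ)` is finite-dimensional over `ℚ̄_p`** as well.
[cite: FontaineAsterisque223III, Prop. 1.4.2 and Thm. 1.5.2] [cite: Patrikis2019, §2.7.1] -/
theorem finiteDimensional_labelFilD_padicAlgCl [FiniteDimensional ℚ_[p] K]
    (𝔅 : PeriodRingData.{0, 0, 0, 0} (absoluteGaloisGroup K) ℚ_[p] K) {n : ℕ}
    (ρ : FramedRep (absoluteGaloisGroup K) (PadicAlgCl p) n) (τ : K →ₐ[ℚ_[p]] PadicAlgCl p) (i : ℤ) :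
    FiniteDimensional (PadicAlgCl p) (𝔅.labelFilD (FramedRep.toContinuousRep ρ) τ.toRingHom i) := by
  haveI := finiteDimensional_labelD_padicAlgCl 𝔅 ρ τ
  exact Submodule.finiteDimensional_of_le (𝔅.labelFilD_le _ _ i)

/-- And **`ρ` has finitely many labelled Hodge–Tate weights at `τ`, at most `dim D_τ(ρ)`** — in the
precise form `card HT_τ(ρ) = dim_{ℚ̄_p} D_τ(ρ)` (`card_labelledHodgeTateWeights_eq_finrank`), now
unconditionally meaningful. [cite: Patrikis2019, §2.7.1] -/
theorem card_labelledHodgeTateWeights_eq_finrank_padicAlgCl [FiniteDimensional ℚ_[p] K]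
    (𝔅 : PeriodRingData.{0, 0, 0, 0} (absoluteGaloisGroup K) ℚ_[p] K) {n : ℕ}
    (ρ : FramedRep (absoluteGaloisGroup K) (PadicAlgCl p) n) (τ : K →ₐ[ℚ_[p]] PadicAlgCl p) :
    Multiset.card (𝔅.labelledHodgeTateWeights (FramedRep.toContinuousRep ρ) τ.toRingHom) =
      Module.finrank (PadicAlgCl p) (𝔅.labelD (FramedRep.toContinuousRep ρ) τ.toRingHom) := by
  haveI := finiteDimensional_labelD_padicAlgCl 𝔅 ρ τ
  exact 𝔅.card_labelledHodgeTateWeights_eq_finrank _ _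

end FramedRep

end Literature.NumberTheory.GaloisRepresentations

/-! ### §3 THE pinned datum -/

namespace Literature.NumberTheory.PAdicHodge

open ValuativeRel IsDedekindDomain
open Literature.NumberTheory.GaloisRepresentations

variable {F : Type} [Field F] [ValuativeRel F] [TopologicalSpace F] [IsNonarchimedeanLocalField F]
  [CharZero F] {p : ℕ} [Fact p.Prime]

/-- **`D_τ(ρ)` is finite-dimensional over `ℚ̄_p` for Fontaine's `B_dR(F)` and every continuous
`ρ : Γ_F → GL_n(ℚ̄_p)`** (`F/ℚ_p` finite; no de Rham hypothesis) — the pinned form of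
`FramedRep.finiteDimensional_labelD_padicAlgCl`. [cite: FontaineAsterisque223III, Prop. 1.4.2 and Thm. 1.5.2]
[cite: BuzzardGeeLMS2014, footnote to Conj. 3.2.1] -/
theorem fontainePst_finiteDimensional_labelD (hp : valuation F p < 1) {n : ℕ}
    (ρ : FramedRep (absoluteGaloisGroup F) (PadicAlgCl p) n) :
    letI := (fontainePst F p hp).algebra
    ∀ τ : F →ₐ[ℚ_[p]] PadicAlgCl p,
      FiniteDimensional (PadicAlgCl p)
        ((fontainePst F p hp).𝔅.labelD (FramedRep.toContinuousRep ρ) τ.toRingHom) := by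
  letI := (fontainePst F p hp).algebra
  haveI := fontainePst_finiteDimensional hp
  intro τ
  exact FramedRep.finiteDimensional_labelD_padicAlgCl (fontainePst F p hp).𝔅 ρ τ

end Literature.NumberTheory.PAdicHodge

end
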